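import Mathlib
import HarnessLib
import HarnessLib.Audit
import Summits.KontsevichZagierPeriods.Statement
import HarnessLib.Audit.Status.Attr

/-!
Route: RootDecompBigradedDescent

# Route RootDecompBigradedDescent — KZ splits exactly into planar areas, weight-two descent,
genus-zero pairs, mixed pairs and descent onto their join

ROOT-DECOMP node (cell decomp-kz, lens 1 «grading / quantitative ladder», generation 2), exact: S ⟺
PlanarAreas ∧ AreaDescentTwo ∧
GenusZeroPairs ∧ MixedPairs ∧ JoinDescent. Grade the kernel of the KZ calculus by TWO transverse
axes — dimension (cut at the theorem
frontier d = 2: W₂ = KZ-rational representations of dimension ≤ 2) and genus (GZ = genus-zero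
representations: iterated integrals of
regular top forms on M_(0,k+3) over the open ordered simplex, all dimensions) — and decompose along
the JOIN W = W₂ ⊔ GZ: the sector
kernel Z(W) splits as Z(W₂) ∧ Z(GZ) ∧ Cross(W₂,GZ) with Z(W₂) ⟺ PlanarAreas ∧ AreaDescentTwo
(generation 0), and the residual Desc(W)
is implied by BOTH one-axis residuals (node A's KernelDescentTwo and the pair form of
LinRedNormalForm's ResidualBeyondGenusZero).
X = the five-fold conjunction; parts: rung 1 (areas), relative rung 2 (weight 2 mod areas),
genus-zero pairs, mixed pairs, join descent.
ROOT DECOMPOSITION CELL decomp-kz (D-0178), GENERATION 2, node A′ = lens-1 «BigradedDescent»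
(HOME/decomp-kz-lens-1/g2/BigradedDescent.lean v1 sha256
b96c9ad542ed6f3cad604c19b9d5b35c4e741483062445a8baa584e2b1be7c39: summit_iff_split, node_iff_join
(node ⟺ Z(W₂ ⊔ GZ) ∧ Desc(W₂ ⊔ GZ)), the generic lattice laws summit_iff_sector_and_descent /
descentTo_iff_summit_of_sector / descentTo_mono / sectorPairs_join_iff, `closes` 5/5 binders, 5
necessity theorems; rc 0, 0 sorry, std axioms), CLEARED by the critic decomp-kz-crit-1
2026-08-30T02:41:57Z (HOME/STATUS.md; CRITIC-LEDGER row «lens-1 gen-2 BigradedDescent v1»; probe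
HOME/critic/L1g2_BigradedDescent_v1_probe.lean rc 0 std): EXACT 5-piece AND-node = the JOIN of node
A's dimension cut W₂ (RootDecompDescentLadder, gen 0) with the tree's genus-zero / mixed-Tate world
GZ (LinRedNormalForm binders verbatim); new objects = the cross term MixedPairs and the joint
residual JoinDescent (novelty grade per critic: new-combination — fine for a decomposition cell).
Typed by the cell writer decomp-kz-writer-1 as an OR-sibling RootDecompBigradedDescent (critic w1
option «birth», writer's call: node A keeps its 3-piece `closes`; 23649 KernelDescentTwo is NOT an
item here, cited as shrink source 23649 ⟹ JoinDescent); shared items 4990, 23648;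
tribunal_fit.residual = JoinDescent. Native `closes` certification rc 0; BC2 C → S probes FAIL 5/5
(lens + writer); BC7 recorded; tribunal pre-check recorded in the writer folder. Tags: PlanarAreas
4990 SHARED WEAKER·ATTACKABLE · AreaDescentTwo 23648 SHARED WEAKER·IDEA-NEEDED+INSTRUMENTABLE ·
GenusZeroPairs NEW WEAKER·(top layer BARRIER-adjacent | sub-layer ATTACKABLE+INSTRUMENTABLE) ·
MixedPairs NEW WEAKER·(k ≥ 3 BARRIER-adjacent | weight-0 ATTACKABLE) · JoinDescent NEW
DECLARED-RESIDUAL(Z(W₂ ⊔ GZ))·IDEA-NEEDED. Census ask (critic): register «sector ∧ descent at an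
arbitrary world W» as an EQ-family row with the costume boundary descentTo_iff_summit_of_sector.
census of record HOME/census/COSTUME-CENSUS-v2.md sha256
f4582ebbd0eecb48bde0fc748f10348233e83bb337e1ddbe9afe10142a7be0ba (json 6b9e3db3…061f). WHY THIS IS
NOVEL: the first two-axis (dimension × genus) grading of the kernel of the KZ calculus with the
cross term typed — pairs (dimension ≤ 2 representation, genus-zero representation) of equal value —
so that «weight separation» between 1-periods/weight-2 numbers and MZVs becomes an item of its own
beside the two one-axis sectors, and the joint residual is certified below both one-axis residuals.
Rung currency: rung 0 — nothing here proves the summit.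
Lean: `PlanarAreas → AreaDescentTwo → GenusZeroPairs → MixedPairs → JoinDescent →
KontsevichZagierPeriods`

## Assembly
Pure logic over the move group: JoinDescent lands the given rational pair on an equal-valued pair
(s, s′) inside W₂ ⊔ GZ at the cost of
one element of KZ.relations; case split on the landing bigrade: (W₂,W₂) → AreaDescentTwo then
PlanarAreas (two more relations);
(GZ,GZ) → GenusZeroPairs; (W₂,GZ) → MixedPairs; (GZ,W₂) → MixedPairs and neg_mem. Four additions in
KZ.relations and `abel`
(deciding theorem `closes` in glue.lean, elaborated: Sketch.lean rc 0, axioms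
propext/Classical.choice/Quot.sound). The converse S ⟹
each piece and the kernel identity node ⟺ Z(W₂ ⊔ GZ) ∧ Desc(W₂ ⊔ GZ) are proved in
BigradedDescent.lean (summit_iff_split, node_iff_join).

Rationale: WHY THIS LINE. For every landing world W the format S ⟺ Z(W) ∧ Desc(W) is exact for free and Desc(W)
is ≡ S exactly when Z(W) is a theorem
(summit_iff_sector_and_descent, descentTo_iff_summit_of_sector in
HOME/decomp-kz-lens-1/BigradedDescent.lean), so a node's content
is the choice of W and the per-piece evidence; generation 0 chose W₂ (critic: shrink the residual),
lens 6 cut the same dimension axis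
again (critic: not a shrink by itself), so this generation joins the transverse axis the literature
actually climbs — the genus-zero /
mixed-Tate tower (BrownENS2009 Thm 1.1: periods of M_(0,n) are MZVs; Brown2012 = arXiv:1102.1312 Thm
1.1: motivic MZVs are spanned by
Hoffman elements, the weight being a grading, p.14; GoncharovManin2004) — where the tree already
holds move-side machinery
(StuffleInKZ, HoffmanRelationInKZ PROVED; HoffmanSpanInKZ 15044, DihedralNormalForm, MzvKernelInKZ
3914 open; WheelThreeSpokes 3913
PROVED). The lattice laws are proved: the residual SHRINKS under joins (descentTo_mono:
KernelDescentTwo ⟹ JoinDescent and Desc(GZ) ⟹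
JoinDescent) while the sector kernel GROWS by exactly one cross term (sectorPairs_join_iff), and
that cross term MixedPairs — an
MZV-algebra number equal to a weight-≤2 number must be connected by moves — is a piece no route or
lens has typed (value shadow:
'no relations between multiple zeta values of different weights', arXiv:1102.1310 p.6). Imported
area: mixed Tate motives / motivic
MZVs (Brown, Goncharov–Manin) on the genus axis, 1-motives (HuberWustholz2022 Thm 13.3) on the
dimension axis; negatives index
(KinematicPlaneConvex 5394) untouched.

RANKED CRUXES. #2 AreaDescentTwo (crux) — [ROOT-DECOMP decomp-kz gen 2 · node A′ piece = item 23648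
SHARED with RootDecompDescentLadder (tags of gen 0 stand: WEAKER·IDEA-NEEDED+INSTRUMENTABLE) ·
verdict: critic decomp-kz-crit-1 CLEARED 2026-08-30T02:41:57Z (HOME/STATUS.md; CRITIC-LEDGER row
«lens-1 gen-2 BigradedDescent v1»; probe HOME/critic/L1g2_BigradedDescent_v1_probe.lean rc 0 std)]
shared item stmt-KontsevichZagierPeriods-23648 VERBATIM (node A piece P2): any two KZ-rational
representations of dimensions ≤ 2 with equal values differ, modulo the KZ move group, from a pair of
planar ℚ-semialgebraic sets of equal area (relative rung 2: weight ≤ 2 modulo 1-periods). Tag WEAKER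
(S ⟹ it: areaDescentTwo_of_summit; it ⟹ S unknown, probe fails); leaf IDEA-NEEDED + INSTRUMENTABLE
(weight-2 identity census). [difficulty: open-problem] (why it might fail: a numerical identity
among dilogarithm / log·log / π·log values at rational arguments not generated by functional
equations realisable as semialgebraic moves with convergent intermediates (Zagier's conjecture false
or only non-effective); AlgebraicPrimitivesObstruction at a non-zero residue.)
[KontsevichZagier2001, HuberWustholz2022, Ayoub2015, arXiv:1805.10104]
#3 PlanarAreas (crux) — [ROOT-DECOMP decomp-kz gen 2 · node A′ piece = item 4990 SHARED (KZ_le 1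
sub-layer; WEAKER·ATTACKABLE closed mod print + INSTRUMENTABLE) · verdict: critic decomp-kz-crit-1
CLEARED 2026-08-30T02:41:57Z (HOME/STATUS.md; CRITIC-LEDGER row «lens-1 gen-2 BigradedDescent v1»;
probe HOME/critic/L1g2_BigradedDescent_v1_probe.lean rc 0 std)] shared item
stmt-KontsevichZagierPeriods-4990 VERBATIM (node A piece P1): two dimension-2 representations with
integrand 1 (planar ℚ-semialgebraic sets) of equal area are KZ-equivalent (rung 1 = real 1-periods).
Tag WEAKER; leaf ATTACKABLE (value theory complete: Huber–Wüstholz Thm 13.3(2); tree closes it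
conditionally on the named fact HuberWustholzCurvePeriods) + INSTRUMENTABLE (equality of 1-periods
decidable, arXiv:2505.20397). [difficulty: XL] (why it might fail: an equal-area pair whose
Huber–Wüstholz relation runs through a correspondence of curves of high degree may admit no
semialgebraic scissors realisation with absolutely convergent intermediate representations.)
[KontsevichZagier2001, HuberWustholz2022, arXiv:2505.20397, arXiv:1805.10104]
#4 GenusZeroPairs (crux) — [ROOT-DECOMP decomp-kz gen 2 · node A′ piece GZ · tag WEAKER — S ⟹ P
(kernel/pair); NEW as an item but = the tree's genus-zero kernel in PAIR form (edge
genusZeroPairs_of_genusZeroKernel from LinRedNormalFormResidualBeyondGenusZeroStrength; fed by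
DihedralNormalForm 3917 ∧ HoffmanSpanInKZ 15044 ∧ HoffmanIndependence 15045); GZ sector absorbing?
against (GZ values are MZVs = periods of MT(ℤ); absorption would put ω(E) in the MZV algebra) ·
critic TAG CORRECTION (w2): top layer BARRIER-adjacent (HoffmanIndependence 15045 = Zagier's
dimension conjecture ⊇ irrationality of ζ(5), the transcendence wall), with the ATTACKABLE sub-layer
(move-realisation of known MZV relations: stuffle / Hoffman / pentagon double shuffle in tree;
HoffmanSpanInKZ = Brown 2012 by moves, open programme) + INSTRUMENTABLE · NECESSARY (binder h₃) ·
census of record HOME/census/COSTUME-CENSUS-v2.md sha256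
f4582ebbd0eecb48bde0fc748f10348233e83bb337e1ddbe9afe10142a7be0ba (json 6b9e3db3…061f) · verdict:
critic decomp-kz-crit-1 CLEARED 2026-08-30T02:41:57Z (HOME/STATUS.md; CRITIC-LEDGER row «lens-1
gen-2 BigradedDescent v1»; probe HOME/critic/L1g2_BigradedDescent_v1_probe.lean rc 0 std)] NEW (pair
form of the genus-zero kernel; binders verbatim those of LinRedNormalForm items 3917 /
DihedralNormalForm): two genus-zero representations — open ordered simplex, integrand P(t)/(∏ tᵢ^bᵢ
∏ (1−tᵢ)^cᵢ ∏_(i<j) (tᵢ−tⱼ)^aᵢⱼ), P ∈ ℚ[t], any dimensions — with equal values are KZ-equivalent.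
Values = the MZV algebra, all weights (BrownENS2009 Thm 1.1). Tag WEAKER (S ⟹ it via the kernel form
kzKernelConjecture_iff_isRational; it ⟹ S unknown: it never leaves genus zero); certified edges:
genus-zero KERNEL (2nd conjunct of
LinRedNormalFormResidualBeyondGenusZeroStrength.kzKernelConjecture_iff_residual_and_genusZeroKernel)
⟹ it (genusZeroPairs_of_genusZeroKernel), hence DihedralNormalForm ∧ MzvKernelInKZ ⟹ it and
HoffmanSpanInKZ ∧ HoffmanIndependence ∧ DihedralNormalForm ⟹ it [tree]. Leaf: ATTACKABLE sub-layer
(geometric/motivic relations as move chains: HoffmanSpanInKZ 15044, DihedralNormalForm; duality =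
one linear change of variables; stuffle PROVED) + IDEA-NEEDED (transcendence leaf
HoffmanIndependence 15045 = Zagier's conjecture) + INSTRUMENTABLE (MZV datamine: every proven
relation up to weight 12 ↦ does a move certificate exist). [difficulty: open-problem] (why it might
fail: one real ℚ-linear relation among MZVs that is not motivic (HoffmanIndependence false), or a
motivic relation (regularised double shuffle / associator) admitting no move chain with absolutely
convergent intermediate representations (HuberMullerStach2017 Rem 13.1.8: rules may be weaker than
motives).) [BrownENS2009, arXiv:1102.1312, arXiv:1102.1310, GoncharovManin2004,
IharaKanekoZagier2006, KontsevichZagier2001]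
#5 MixedPairs (crux) — [ROOT-DECOMP decomp-kz gen 2 · node A′ piece Mixed = the CROSS TERM W₂ × GZ
(«weight separation») · tag WEAKER — S ⟹ it (mixedPairs_of_summit); new content from GZ-dimension 3
on (GZ_{≤2} ⊆ W₂: crossPairs_wTwo_of_sectorPairs_wTwo) · critic TAG CORRECTION (w2): its k ≥ 3 layer
is transcendence-open (ζ(3) ∉ ℚ + ℚπ² unknown) ⟹ BARRIER-adjacent; ATTACKABLE weight-0 sub-layer
(polynomial integrands over Δ_k ↦ rational constants by k Newton–Leibniz moves) provable-now ·
NECESSARY (binder h₄) · NEW · score gen 3 (w3): a cross-term THEOREM (weight-0 / GZ-dim ≤ 2 layers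
kernel-closed) · verdict: critic decomp-kz-crit-1 CLEARED 2026-08-30T02:41:57Z (HOME/STATUS.md;
CRITIC-LEDGER row «lens-1 gen-2 BigradedDescent v1»; probe
HOME/critic/L1g2_BigradedDescent_v1_probe.lean rc 0 std)] NEW (the cross term of the join, «weight
separation»): a KZ-rational representation of dimension ≤ 2 and a genus-zero representation (as in
GenusZeroPairs) with equal values are KZ-equivalent. Tag WEAKER (S ⟹ it: mixedPairs_of_summit; it ⟹
S unknown — it quantifies over cross pairs only and no mechanism moves an arbitrary pair into W₂ ×
GZ position); genuinely new content starts in genus-zero dimension 3 (dimension-≤2 genus-zero reps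
that are KZ-rational fall under Z(W₂): crossPairs_wTwo_of_sectorPairs_wTwo). Leaf: ATTACKABLE
sub-layer (weight-0 part: [Δ_k, P(t)] ↦ [pt, ∫P] by k Newton–Leibniz moves with polynomial
primitives; [Δ₂, 1/((1−t₁)t₂)] = ζ(2) vs the dim-2 rational rep of π²/6 = EulerFormChain territory)
+ IDEA-NEEDED (value shadow = inhomogeneous MZV relations: 'no relations between MZVs of different
weights' is open even for ζ(3) ∉ ℚ + ℚπ²) + INSTRUMENTABLE (PSLQ of MZVs of weight 3–6 against (1,
π, π², log 2, π log 2, log²2, Li₂(1/2), Catalan) to 80 digits; expected: only the known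
weight-homogeneous products). [difficulty: open-problem] (why it might fail: a genus-zero rep of
dimension ≥ 3 whose value lands in the weight-≤2 world (numerator mixing weights, or an unexpected
inhomogeneous MZV identity) with no dimension-lowering move chain — fibrewise descent is what
AlgebraicPrimitivesObstruction forbids at non-zero residues.) [arXiv:1102.1310, arXiv:1102.1312,
BrownENS2009, KontsevichZagier2001, Ayoub2015]
#6 JoinDescent (crux) — [ROOT-DECOMP decomp-kz gen 2 · node A′ piece Join · tag
DECLARED-RESIDUAL(Z(W₂ ⊔ GZ)) (critic_residual_shape); tribunal_fit.residual = this decl · shrink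
certified on both axes (critic_shrinks: ⟸ RootDecompDescentLadder.KernelDescentTwo 23649, ⟸
Desc(GZ)) — real but AUTOMATIC under any join (GENERIC-LAW DOCTRINE: summit_iff_sector_and_descent
makes S ⟺ Z(W) ∧ Desc(W) exact for free at every inhabited world W and Desc is antitone,
critic_shrink_is_automatic; the score of a world-join is the honesty of the sector pieces and the
cross term, not the shrink; costume boundary descentTo_iff_summit_of_sector stated by the lens) ·
carries everything outside W₂ ∪ MT(ℤ): π·ω, CY, depth/level-N polylogs at algebraic points, Feynman
… · leaf IDEA-NEEDED · verdict: critic decomp-kz-crit-1 CLEARED 2026-08-30T02:41:57Z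
(HOME/STATUS.md; CRITIC-LEDGER row «lens-1 gen-2 BigradedDescent v1»; probe
HOME/critic/L1g2_BigradedDescent_v1_probe.lean rc 0 std)] NEW residual, DECLARED-RESIDUAL(Z(W₂ ⊔
GZ)) — do not attempt directly: any two KZ-rational representations with equal values differ, modulo
the KZ move group, from an equal-valued pair of representations each of which is KZ-rational of
dimension ≤ 2 OR genus-zero. S ⟹ it (joinDescent_of_summit, empty witnesses); it ⟹ S unknown today
and ≡ S exactly when the four sector pieces are theorems (joinDescent_iff_summit_of_sector);
certified shrinks along both axes: KernelDescentTwo (23649) ⟹ it (joinDescent_of_kernelDescentTwo),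
Desc(GZ) ⟹ it (joinDescent_of_genusZeroDescent). Leaf IDEA-NEEDED (what remains: non-mixed-Tate
periods of dimension ≥ 3 — elliptic and higher-genus letters, Γ-value detours, K3/Calabi–Yau periods
— modulo everything the two towers see). [difficulty: open-problem] (why it might fail: a rational
pair with a non-mixed-Tate member of dimension ≥ 3 (a CM elliptic period times π, a Γ-product) whose
difference has no move chain into W₂ ⊔ GZ; no descent mechanism beyond fibrewise Fubini/Stokes is
known (AlgebraicPrimitivesObstruction, GrothendieckPeriodConjectureDependence).)
[KontsevichZagier2001, HuberMullerStachPeriods2017, Ayoub2015, CressonViusos2022]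

TWO-LAYER PLAN. Foreseen glued splits (none filed now): GenusZeroPairs ⇐ DihedralNormalForm →
HoffmanSpanInKZ → HoffmanIndependence → GenusZeroPairs
(the LinRedNormalForm sector chain, glue = genusZeroPairs_of_genusZeroKernel ∘
genusZeroKernel_of_sector [tree]); MixedPairs ⇐
(weight-0 rung: polynomial simplex integrals ↦ constants) → (weight-homogeneous part: dimension-k
genus-zero rep of pure weight ≤ 2 ↦
W₂ by unfolding) → (weight separation for mixed numerators) → MixedPairs; AreaDescentTwo ⇐
residue-free sector (KZ-degree ≤ 1, decided
by rung 1: KzOnePeriodsDim2Descent) → logarithmic genus-0 sector (dilogarithms) → genus ≥ 1 length-2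
sector → AreaDescentTwo.

KILL CRITERIA. A refutation of ANY piece refutes the summit itself (every piece is implied by S:
*_of_summit), so no refutation closes the route
while KZ stands; the route is mooted (superseded) if KZ_leRat 2 ∧ GenusZeroPairs ∧ MixedPairs are
proved elsewhere — then JoinDescent
≡ S (joinDescent_iff_summit_of_sector) and the node must be re-cut one join higher (add the
genus-one / elliptic tower). Pivot: if
HoffmanSpanInKZ dies on convergence grounds (no move chains for regularised relations),
GenusZeroPairs is re-scoped to the
convergent-cell-zeta sub-sector (BrownCarrSchneps2010) and the rest joins the residual.

NOT DECOMPOSED YET. The genus-one / elliptic tower (elliptic MZVs, iterated Eisenstein integrals) is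
deliberately not a third axis at this generation
(no typed sector in the tree; it is where JoinDescent's bulk lives); the weight sub-grading inside
GenusZeroPairs and the genus/residue
sub-grading inside AreaDescentTwo are layer-2 children (Two-layer plan); no truncated calculi
(relationsLE d) anywhere — every piece
concludes in KZ.relations through all dimensions.

CHEAPEST FALSIFIER. PSLQ/LLL to 80 digits on (ζ(3), ζ(5), ζ(3)², ζ(3,5), …, 1, π², π⁴, log 2·π²,
log²2, Li₂(1/2)): any inhomogeneous-weight relation
would give a MixedPairs instance with no conceivable move chain and would contradict Brown's weight
grading conditional on the period
conjecture — none is expected (MZV datamine to weight 22 finds only homogeneous relations). In Lean: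
the vacuity/BC2/non-decoration
probes (bc/probes.lean: 15/15 fail as intended) and #h21_crux_probe (5/5 CLEAN) were run; nothing
cheap kills or trivialises a piece.

NUMBERS. Weight ≤ 1: Baker (KZ_leRat 1 PROVED in tree); 1-periods: Huber–Wüstholz Thm 13.3
(complete, qualitative); weight 2: open (first typed
stops PiLogTwoWeightLeTwoIndependent, TernaryQuadraticLogIndependent); MZV dimensions d_k ≤ Zagier's
bound PROVED (Terasoma, Deligne–
Goncharov, Brown 2012), equality d_k = dim OPEN from weight 3 on (ζ(3)/π³ ∉ ℚ unknown); MZV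
datamine: all relations to weight 22
consistent with motivic ones.

DEFINITION REQUESTS. None: genus-zero shape, KZ-rationality, relations and Equivalent are all
existing declarations (KZCalculus); W₂/GZ are inlined.

Novelty: Searches (2026-08-30): lit search --hybrid "periods of moduli spaces M_(0,n) are multiple zeta
values Brown" (6 docs: arXiv-1410.6348 bi-arrangements pp 66,47; book:marcolli2009-feynman-motives
p129; galaxy-pdf Brown 'Irrationality proofs … moduli spaces' p49; Glanois thesis p177); lit search
--hybrid "Kontsevich Zagier period conjecture mixed Tate motives multiple zeta values motivic
relations" (6 docs: periods-GKZ.pdf p2, huber2022 pp 10–13, marcolli2009, Coates–Taylor, Voevodsky,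
Kerr–Pearlstein — none on a join decomposition); lit search "weight grading multiple zeta values
different weights linearly independent conjecture" (local 6: arXiv-1102.1312 p14, conm-648 p8,
arXiv-1102.1310 p6, math/0601151 p1, 2403.18075 p12, 1910.01107 p22; crossref 6); lit galaxy search
"mixed Tate periods|period conjecture|motivic multiple zeta" --star all (16 rows: panama 8 noise,
pdf 8 incl. Soudères hal-00742591 cycle complex toward MZV, Connes–Fauvet–Ramis IRMA 15; crabby 0);
tree: rg GenusZero|MzvKernel|Hoffman|ArrangementNormalForm in Theses/Theorems (LinRedNormalForm
items 3913–3917, 14821, 15044–45; Strength/OneRep/Forms files), HOME/STATUS.md NODE lines of lenses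
2–6 (no genus/mixed-Tate axis), ledger negatives (1 entry, unrelated).
Nearest prior art found: tree route LinRedNormalForm (S ⟸ DihedralNormalForm ∧ MzvKernelInKZ ∧
ResidualBeyondGenusZero; Strength file: KZKernelConjecture ⟺ residual ∧ genus-zero kernel) [tree];
node A = route-KontsevichZagierPeriods-RootDecompDescentLadde  [refs: book:marcolli2009-feynman-motives, paper:arxiv-1102.1312, paper:arxiv-1102.1310, paper:arxiv-1410.6348]

Barriers (technique_class: kernel-descent, dimension-ladder, genus-zero, mixed-tate): - technique_class: kernel-descent, dimension-ladder, genus-zero, mixed-tate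
- Literature.Barriers.KontsevichZagierPeriods.noSemialgebraicPrimitive_inv_sub_two:
(AlgebraicPrimitivesObstruction, with algebraicPrimitivesObstructionNarrow) every piece concludes `∈
KZ.relations` (moves through ALL dimensions, no relationsLE d), so no piece asserts fixed-variable
Stokes generation; the barrier is WHERE the difficulty of AreaDescentTwo (non-zero residues at
weight 2) and of the descent direction of MixedPairs/JoinDescent lives — named as their leaf tags,
not evaded; GenusZeroPairs sits outside it on its attackable sub-layer (hyperlogarithm primitives
along forgetful fibrations ARE algebraic-times-unfolded-simplex data: BrownENS2009, the
LinRedNormalForm mechanism).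
- Literature.Barriers.KontsevichZagierPeriods.kzConjecture_implies_oddZetaAlgIndep:
(GrothendieckPeriodConjectureDependence, with kzConjecture_implies_twoPiI_log_algIndep and
kzConjecture_implies_ellipticPeriods_algIndep) PlanarAreas sits below it (1-motives, Wüstholz);
GenusZeroPairs carries exactly the MT(ℤ) slice (HoffmanIndependence = Zagier's conjecture) as a
declared transcendence leaf with a motivic, attackable complement; MixedPairs carries the
weight-separation slice; JoinDescent the rest — the bet is that the genus axis is the one slice of
GPC with a complete motivic theory (Brown 2012) and a working move-side programme in the tree.
- Literature.Barriers.KontsevichZagierPeriods.cressonViuSos_prop_3_2: (Hauptverm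

sub-problem: KontsevichZagierPeriods · status: open · opened planner-decomp-kz-writer-1-g0-0 2026-08-30T03:03:01Z · rev 0 · ledger route-KontsevichZagierPeriods-RootDecompBigradedDescent
GENERATED by the gate from the ledger (D-0016/17). Provers cite these decls: `theorem foo : Summit.KontsevichZagierPeriods.KontsevichZagierPeriods.Theses.RootDecompBigradedDescent.<Decl> := …` in Summits/KontsevichZagierPeriods/KontsevichZagierPeriods/Theorems/<Name>.lean.
-/

namespace Summit.KontsevichZagierPeriods.KontsevichZagierPeriods.Theses.RootDecompBigradedDescent

open scoped BigOperators Topology Manifold Classical MeasureTheory ProbabilityTheory Matrix InnerProductSpace ComplexConjugate ContinuousMap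
open Filter Set Function TopologicalSpace MeasureTheory

attribute [summit_statement] _root_.KontsevichZagierPeriods

open Literature Periods

/-- item stmt-KontsevichZagierPeriods-23648 · crux · rank 2 · open · by planner
why it might fail: a numerical identity among dilogarithm / log·log / π·log values at rational arguments not generated by functional equations realisable as semialgebraic moves with convergent intermediates (Zagier's conjecture false or only non-effective); AlgebraicPrimitivesObstruction at a non-zero residue.
sources: KontsevichZagier2001, HuberWustholz2022, Ayoub2015, arXiv:1805.10104
[crux] [ROOT-DECOMP decomp-kz gen 0 · node A piece P2 · tag WEAKER — S ⟹ P2 by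
`areaDescentTwo_of_summit` (empty planar witnesses; HOME/decomp-kz-lens-1/DescentLadder.lean sha256
66c5f0813a3b3b46f50f38f2b88984b37c28aefc52affb616c64712b87b2e29e); P2 ⟹ S NOT known: kernel sandwich
KZ_leRat 2 ⟹ P2 ⟹ (PlanarAreas → KZ_leRat 2) and P1 ∧ P2 ⟺ KZ_leRat 2
(`critic_p1_and_p2_iff_ratRung`), BC2 probe P2 → S FAILS · NECESSARY (binder h₂ of `closes`) · leaf
IDEA-NEEDED + INSTRUMENTABLE (census instrument I2 = weight-2 identity census; no census data file
yet: HOME/census/ empty at filing) · the lens-claimed BARRIER placement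
(AlgebraicPrimitivesObstruction, GPC weight-2 slice) is NOT certified by the critic as typed ·
verdict: critic decomp-kz-crit-1 CLEARED 2026-08-30T01:20:03Z (HOME/CRITIC-LEDGER.md row «lens-1
DescentLadder v1»; probe HOME/critic/L1_DescentLadder_v1_probe.lean rc 0, std axioms)] any two
KZ-rational integral representations of dimensions ≤ 2 with equal values differ, modulo the KZ move
group, from a pair of planar ℚ-semialgebraic sets (dimension-2 representations with integrand 1) of
equal area (piece P2, relative rung 2: weight ≤ 2 modulo weight ≤ 1; S ⟹ it with the empty p -/
@[route_item "route-KontsevichZagierPeriods-RootDecompBigradedDescent", crux]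
def AreaDescentTwo : Prop :=
  ∀ ⦃n m : ℕ⦄, n ≤ 2 → m ≤ 2 → ∀ (r : Literature.NumberTheory.Transcendental.KZ.IntegralRep n) (r' : Literature.NumberTheory.Transcendental.KZ.IntegralRep m), r.IsRational → r'.IsRational → r.value = r'.value → ∃ A A' : Literature.NumberTheory.Transcendental.KZ.IntegralRep 2, (∀ p ∈ A.domain, A.integrand p = 1) ∧ (∀ p ∈ A'.domain, A'.integrand p = 1) ∧ A.value = A'.value ∧ Literature.NumberTheory.Transcendental.KZ.of r - Literature.NumberTheory.Transcendental.KZ.of r' - (Literature.NumberTheory.Transcendental.KZ.of A - Literature.NumberTheory.Transcendental.KZ.of A') ∈ Literature.NumberTheory.Transcendental.KZ.relations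

/-- item stmt-KontsevichZagierPeriods-4990 · crux · rank 3 · open · by planner
why it might fail: an equal-area pair whose Huber–Wüstholz relation runs through a correspondence of curves of high degree may admit no semialgebraic scissors realisation with absolutely convergent intermediate representations.
sources: KontsevichZagier2001, HuberWustholz2022, arXiv:2505.20397, arXiv:1805.10104
[crux] curved planar Hilbert III over ℚ̄ inside the rules (card (B)(ii), depth 1 of the layer): two
2-dim representations with integrand 1 — i.e. two ℚ-semialgebraic planar sets of finite area — with
the same area are KZ-equivalent. Areas of planar ℚ-semialgebraic sets are exactly the
(ℚ̄∩ℝ)-combinations of real 1-periods ∫ (ψ − φ) dx over algebraic arcs (Newton–Leibniz along y with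
primitive y, and back by subgraphs), so this is Huber–Wüstholz's theorem 'all ℚ̄-linear relations
among 1-periods come from bilinearity and functoriality of pairs (C, D)' (Thm 13.3) TRANSFERRED:
every such relation — isogenies and correspondences between curves, Cauchy/residue relations among
real ovals, exact algebraic forms — must be a chain of real semialgebraic moves. Equality of two
such areas is decidable today (SertozOuaknineWorrell2025); the claim is that it is derivable. Shares
its 1-dim content with LowDimension items 0117/0510 (informal, definition-blocked) and its elliptic
sectors with HermiteRigidity. [difficulty: XL] -/
@[route_item "route-KontsevichZagierPeriods-RootDecompBigradedDescent", crux]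
def PlanarAreas : Prop :=
  ∀ (r r' : Literature.NumberTheory.Transcendental.KZ.IntegralRep 2), (∀ p ∈ r.domain, r.integrand p = 1) → (∀ p ∈ r'.domain, r'.integrand p = 1) → r.value = r'.value → Literature.NumberTheory.Transcendental.KZ.Equivalent r r'

/-- item stmt-KontsevichZagierPeriods-26156 · crux · rank 4 · open · by planner
why it might fail: one real ℚ-linear relation among MZVs that is not motivic (HoffmanIndependence false), or a motivic relation (regularised double shuffle / associator) admitting no move chain with absolutely convergent intermediate representations (HuberMullerStach2017 Rem 13.1.8: rules may be weaker than motives).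
sources: BrownENS2009, arXiv:1102.1312, arXiv:1102.1310, GoncharovManin2004, IharaKanekoZagier2006, KontsevichZagier2001
[crux] [ROOT-DECOMP decomp-kz gen 2 · node A′ piece GZ · tag WEAKER — S ⟹ P (kernel/pair); NEW as an
item but = the tree's genus-zero kernel in PAIR form (edge genusZeroPairs_of_genusZeroKernel from
LinRedNormalFormResidualBeyondGenusZeroStrength; fed by DihedralNormalForm 3917 ∧ HoffmanSpanInKZ
15044 ∧ HoffmanIndependence 15045); GZ sector absorbing? against (GZ values are MZVs = periods of
MT(ℤ); absorption would put ω(E) in the MZV algebra) · critic TAG CORRECTION (w2): top layer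
BARRIER-adjacent (HoffmanIndependence 15045 = Zagier's dimension conjecture ⊇ irrationality of ζ(5),
the transcendence wall), with the ATTACKABLE sub-layer (move-realisation of known MZV relations:
stuffle / Hoffman / pentagon double shuffle in tree; HoffmanSpanInKZ = Brown 2012 by moves, open
programme) + INSTRUMENTABLE · NECESSARY (binder h₃) · census of record
HOME/census/COSTUME-CENSUS-v2.md sha256
f4582ebbd0eecb48bde0fc748f10348233e83bb337e1ddbe9afe10142a7be0ba (json 6b9e3db3…061f) · verdict:
critic decomp-kz-crit-1 CLEARED 2026-08-30T02:41:57Z (HOME/STATUS.md; CRITIC-LEDGER row «lens-1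
gen-2 BigradedDescent v1»; probe HOME/critic/L1g2_BigradedDescent_v1_probe.lean rc 0 std)] NEW (pair
form of the -/
@[route_item "route-KontsevichZagierPeriods-RootDecompBigradedDescent", crux]
def GenusZeroPairs : Prop :=
  ∀ ⦃k k' : ℕ⦄ (g : Literature.NumberTheory.Transcendental.KZ.IntegralRep k) (g' : Literature.NumberTheory.Transcendental.KZ.IntegralRep k') (p : MvPolynomial (Fin k) ℚ) (a : Fin k → Fin k → ℕ) (b c : Fin k → ℕ) (p' : MvPolynomial (Fin k') ℚ) (a' : Fin k' → Fin k' → ℕ) (b' c' : Fin k' → ℕ), g.domain = {t | (∀ i, 0 < t i) ∧ (∀ i, t i < 1) ∧ StrictAnti t} → Set.EqOn g.integrand (fun t => MvPolynomial.aeval t p / ((∏ i, t i ^ b i) * (∏ i, (1 - t i) ^ c i) * ∏ i, ∏ j, if i < j then (t i - t j) ^ a i j else 1)) g.domain → g'.domain = {t | (∀ i, 0 < t i) ∧ (∀ i, t i < 1) ∧ StrictAnti t} → Set.EqOn g'.integrand (fun t => MvPolynomial.aeval t p' / ((∏ i, t i ^ b' i) * (∏ i, (1 - t i) ^ c' i)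 * ∏ i, ∏ j, if i < j then (t i - t j) ^ a' i j else 1)) g'.domain → g.value = g'.value → Literature.NumberTheory.Transcendental.KZ.Equivalent g g'

/-- item stmt-KontsevichZagierPeriods-26157 · crux · rank 5 · open · by planner
why it might fail: a genus-zero rep of dimension ≥ 3 whose value lands in the weight-≤2 world (numerator mixing weights, or an unexpected inhomogeneous MZV identity) with no dimension-lowering move chain — fibrewise descent is what AlgebraicPrimitivesObstruction forbids at non-zero residues.
sources: arXiv:1102.1310, arXiv:1102.1312, BrownENS2009, KontsevichZagier2001, Ayoub2015
[crux] [ROOT-DECOMP decomp-kz gen 2 · node A′ piece Mixed = the CROSS TERM W₂ × GZ («weight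
separation») · tag WEAKER — S ⟹ it (mixedPairs_of_summit); new content from GZ-dimension 3 on
(GZ_{≤2} ⊆ W₂: crossPairs_wTwo_of_sectorPairs_wTwo) · critic TAG CORRECTION (w2): its k ≥ 3 layer is
transcendence-open (ζ(3) ∉ ℚ + ℚπ² unknown) ⟹ BARRIER-adjacent; ATTACKABLE weight-0 sub-layer
(polynomial integrands over Δ_k ↦ rational constants by k Newton–Leibniz moves) provable-now ·
NECESSARY (binder h₄) · NEW · score gen 3 (w3): a cross-term THEOREM (weight-0 / GZ-dim ≤ 2 layers
kernel-closed) · verdict: critic decomp-kz-crit-1 CLEARED 2026-08-30T02:41:57Z (HOME/STATUS.md;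
CRITIC-LEDGER row «lens-1 gen-2 BigradedDescent v1»; probe
HOME/critic/L1g2_BigradedDescent_v1_probe.lean rc 0 std)] NEW (the cross term of the join, «weight
separation»): a KZ-rational representation of dimension ≤ 2 and a genus-zero representation (as in
GenusZeroPairs) with equal values are KZ-equivalent. Tag WEAKER (S ⟹ it: mixedPairs_of_summit; it ⟹
S unknown — it quantifies over cross pairs only and no mechanism moves an arbitrary pair into W₂ ×
GZ position); genuinely new content starts in genus-zero dimension 3 (dim -/
@[route_item "route-KontsevichZagierPeriods-RootDecompBigradedDescent", crux]
def MixedPairs : Prop :=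
  ∀ ⦃n k : ℕ⦄ (s : Literature.NumberTheory.Transcendental.KZ.IntegralRep n) (g : Literature.NumberTheory.Transcendental.KZ.IntegralRep k) (p : MvPolynomial (Fin k) ℚ) (a : Fin k → Fin k → ℕ) (b c : Fin k → ℕ), n ≤ 2 → s.IsRational → g.domain = {t | (∀ i, 0 < t i) ∧ (∀ i, t i < 1) ∧ StrictAnti t} → Set.EqOn g.integrand (fun t => MvPolynomial.aeval t p / ((∏ i, t i ^ b i) * (∏ i, (1 - t i) ^ c i) * ∏ i, ∏ j, if i < j then (t i - t j) ^ a i j else 1)) g.domain → s.value = g.value → Literature.NumberTheory.Transcendental.KZ.Equivalent s g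

/-- item stmt-KontsevichZagierPeriods-26158 · crux · rank 6 · open · by planner
why it might fail: a rational pair with a non-mixed-Tate member of dimension ≥ 3 (a CM elliptic period times π, a Γ-product) whose difference has no move chain into W₂ ⊔ GZ; no descent mechanism beyond fibrewise Fubini/Stokes is known (AlgebraicPrimitivesObstruction, GrothendieckPeriodConjectureDependence).
sources: KontsevichZagier2001, HuberMullerStachPeriods2017, Ayoub2015, CressonViusos2022
[crux] [ROOT-DECOMP decomp-kz gen 2 · node A′ piece Join · tag DECLARED-RESIDUAL(Z(W₂ ⊔ GZ))
(critic_residual_shape); tribunal_fit.residual = this decl · shrink certified on both axes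
(critic_shrinks: ⟸ RootDecompDescentLadder.KernelDescentTwo 23649, ⟸ Desc(GZ)) — real but AUTOMATIC
under any join (GENERIC-LAW DOCTRINE: summit_iff_sector_and_descent makes S ⟺ Z(W) ∧ Desc(W) exact
for free at every inhabited world W and Desc is antitone, critic_shrink_is_automatic; the score of a
world-join is the honesty of the sector pieces and the cross term, not the shrink; costume boundary
descentTo_iff_summit_of_sector stated by the lens) · carries everything outside W₂ ∪ MT(ℤ): π·ω, CY,
depth/level-N polylogs at algebraic points, Feynman … · leaf IDEA-NEEDED · verdict: critic
decomp-kz-crit-1 CLEARED 2026-08-30T02:41:57Z (HOME/STATUS.md; CRITIC-LEDGER row «lens-1 gen-2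
BigradedDescent v1»; probe HOME/critic/L1g2_BigradedDescent_v1_probe.lean rc 0 std)] NEW residual,
DECLARED-RESIDUAL(Z(W₂ ⊔ GZ)) — do not attempt directly: any two KZ-rational representations with
equal values differ, modulo the KZ move group, from an equal-valued pair of representations each of
which is KZ-rational of dimensio -/
@[route_item "route-KontsevichZagierPeriods-RootDecompBigradedDescent", crux]
def JoinDescent : Prop :=
  ∀ ⦃n m : ℕ⦄ (r : Literature.NumberTheory.Transcendental.KZ.IntegralRep n) (r' : Literature.NumberTheory.Transcendental.KZ.IntegralRep m), r.IsRational → r'.IsRational → r.value = r'.value → ∃ (k k' : ℕ) (s : Literature.NumberTheory.Transcendental.KZ.IntegralRep k) (s' : Literature.NumberTheory.Transcendental.KZ.IntegralRep k'), ((k ≤ 2 ∧ s.IsRational) ∨ ∃ (p : MvPolynomial (Fin k) ℚ) (a : Fin k → Fin k → ℕ) (b c : Fin k → ℕ), s.domain = {t | (∀ i, 0 < t i) ∧ (∀ i, t i < 1) ∧ StrictAnti t} ∧ Set.EqOn s.integrand (fun t => MvPolynomial.aeval t p / ((∏ i, t i ^ b i) * (∏ i, (1 - t i) ^ c i) * ∏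 i, ∏ j, if i < j then (t i - t j) ^ a i j else 1)) s.domain) ∧ ((k' ≤ 2 ∧ s'.IsRational) ∨ ∃ (p' : MvPolynomial (Fin k') ℚ) (a' : Fin k' → Fin k' → ℕ) (b' c' : Fin k' → ℕ), s'.domain = {t | (∀ i, 0 < t i) ∧ (∀ i, t i < 1) ∧ StrictAnti t} ∧ Set.EqOn s'.integrand (fun t => MvPolynomial.aeval t p' / ((∏ i, t i ^ b' i) * (∏ i, (1 - t i) ^ c' i) * ∏ i, ∏ j, if i < j then (t i - t j) ^ a' i j else 1)) s'.domain) ∧ s.value = s'.value ∧ Literature.NumberTheory.Transcendental.KZ.of r - Literature.NumberTheory.Transcendental.KZ.of r' - (Literature.NumberTheory.Transcendental.KZ.of s - Literature.NumberTheory.Transcendental.KZ.of s') ∈ Literature.NumberTheory.Transcendental.KZ.relations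

/-- item stmt-KontsevichZagierPeriods-26159 · assembly · rank 1 · open · by planner
sources: KontsevichZagier2001
[assembly] PlanarAreas → AreaDescentTwo → GenusZeroPairs → MixedPairs → JoinDescent →
KontsevichZagierPeriods (the schema requires exactly one assembly item; the deciding theorem is
`closes` in glue.lean; self-check reports it as advisory glue.unused-crux, as for node A). -/
@[route_item "route-KontsevichZagierPeriods-RootDecompBigradedDescent"]
def Assembly : Prop :=
  PlanarAreas → AreaDescentTwo → GenusZeroPairs → MixedPairs → JoinDescent → KontsevichZagierPeriods

/-! D-0027 §2.1 — DECIDING THEOREM (planner-authored via `route open/edit --closes-file`; by planner-decomp-kz-writer-1-g0-0 2026-08-30T03:03:01Z):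
its hypotheses are this route's items and its conclusion the sub-problem Statement (glue_lint), and it elaborates with this file. -/

@[closes "route-KontsevichZagierPeriods-RootDecompBigradedDescent"] theorem closes (h₁ : PlanarAreas) (h₂ : AreaDescentTwo) (h₃ : GenusZeroPairs) (h₄ : MixedPairs) (h₅ : JoinDescent) :
    _root_.KontsevichZagierPeriods := by
  rw [KontsevichZagierPeriods_iff]
  intro n m r r' hr hr' hv
  obtain ⟨k, k', s, s', hs, hs', hsv, hd⟩ := h₅ r r' hr hr' hv
  suffices hss : Literature.NumberTheory.Transcendental.KZ.of s - Literature.NumberTheory.Transcendental.KZ.of s' ∈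
      Literature.NumberTheory.Transcendental.KZ.relations by
    have key := Literature.NumberTheory.Transcendental.KZ.relations.add_mem hd hss
    show Literature.NumberTheory.Transcendental.KZ.of r - Literature.NumberTheory.Transcendental.KZ.of r' ∈
      Literature.NumberTheory.Transcendental.KZ.relations
    convert key using 1
    abel
  rcases hs with ⟨hk, hsR⟩ | ⟨p, a, b, c, hdom, hint⟩ <;>
    rcases hs' with ⟨hk', hsR'⟩ | ⟨p', a', b', c', hdom', hint'⟩
  · obtain ⟨A, A', hA, hA', hAv, hd'⟩ := h₂ hk hk' s s' hsR hsR' hsv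
    have key := Literature.NumberTheory.Transcendental.KZ.relations.add_mem hd' (h₁ A A' hA hA' hAv)
    convert key using 1
    abel
  · exact h₄ s s' p' a' b' c' hk hsR hdom' hint' hsv
  · have key := Literature.NumberTheory.Transcendental.KZ.relations.neg_mem (h₄ s' s p a b c hk' hsR' hdom hint hsv.symm)
    convert key using 1
    abel
  · exact h₃ s s' p a b c p' a' b' c' hdom hint hdom' hint' hsv

end Summit.KontsevichZagierPeriods.KontsevichZagierPeriods.Theses.RootDecompBigradedDescent
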